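import Literature.AlgebraicGeometry.FormalGeometry.AffineAdicVectorBundleAlgebraization
import Literature.AlgebraicGeometry.Deformation.GrothendieckExistenceVectorBundlesTower
import Literature.AlgebraicGeometry.Modules.VectorBundleFiniteLocallyFree
import Mathlib.RingTheory.TensorProduct.Quotient
import HarnessLib

/-!
# Grothendieck existence for vector bundles over `W(k)`: the affine case (GW II Thm. 24.94, affine)

Görtz–Wedhorn, *Algebraic Geometry II* (2023), §§(24.18)–(24.19). The named fact
`Literature.AlgebraicGeometry.Deformation.GortzWedhorn2023_thm2494_vectorBundle_witt` (Thm. 24.94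
with Prop. 24.95 for vector bundles over a PROPER `W(k)`-scheme) asserts that a compatible system
`(ℰ_n)_n` of vector bundles on the thickenings `X_{n+1} = 𝒳 ⊗_W W_{n+1}(k)` comes, level by level,
from a vector bundle on `𝒳`. This file PROVES that conclusion in the affine case
`𝒳 = Spec S → Spec W(k)` for a `p`-adically complete `W(k)`-algebra `S` (for `𝒳` proper and affine,
i.e. finite over `W(k)`, `S` is finite over the complete noetherian ring `W(k)` and hence
`p`-adically complete; that implication is not transcribed here):

* `WittAffine.specQuotIso n : Spec (S/p^{n+1}S) ≅ X_{n+1}` — the thickenings of an affine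
  `W(k)`-scheme (`X_{n+1} = Spec S ×_{Spec W} Spec W_{n+1} ≅ Spec (S ⊗_W W_{n+1}) ≅ Spec (S/p^{n+1}S)`,
  Mathlib `pullbackSpecIso` and `Algebra.TensorProduct.quotIdealMapEquivTensorQuot`), with
  `specQuotIso_hom_fst` / `specQuotIso_hom_snd` (compatibility with `X_{n+1} → 𝒳` and
  `X_{n+1} → Spec W_{n+1}`) and `specQuotIso_comm` (compatibility with the transition maps: the
  `specQuotIso n` form an isomorphism between the `p`-adic tower
  `(Spec S/p^{n+1}S)_n` of `Literature.AlgebraicGeometry.FormalGeometry.adicLevel` and the tower of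
  thickenings `(X_{n+1})_n` of `Literature.AlgebraicGeometry.Motives.WittScheme.thickening`);
* `WittAffine.nonempty_iso_of_pullback_hom_iso` — inverse image along an isomorphism of schemes
  reflects isomorphy of modules;
* **`WittAffine.exists_vectorBundle_forall_thickening_iso`** — the theorem: transport the system to
  the `p`-adic tower of `S` (GW Constr. 24.104, base change of modules over towers), apply the affine
  algebraization theorem
  `Literature.AlgebraicGeometry.FormalGeometry.exists_vectorBundle_of_isVectorBundle_adicTower`
  (GW Prop. 24.88 in sheaf form = Cor. 24.90 for locally free modules), and cancel the inverse image
  along the isomorphisms `specQuotIso n`.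

Everything is proved; no named facts are introduced. The general (proper, non-affine) case of the
fact needs in addition GW Lemma 24.103–(24.21) (Serre vanishing on the special fibre, Chow's lemma)
and Prop. 24.95, cf. the module docstring of the fact.

## References

* U. Görtz, T. Wedhorn, *Algebraic Geometry II: Cohomology of Schemes*, Springer Spektrum 2023,
  Prop. 24.88, Cor. 24.90, Thm. 24.94, Constr. 24.104 (pp. 562–571). [GortzWedhorn2023]
-/

noncomputable section

-- `TopCat.Presheaf`/`Scheme.Modules` are not reducible (as in Mathlib's `AlgebraicGeometry/Modules/Tilde.lean`).
set_option backward.isDefEq.respectTransparency false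

open CategoryTheory CategoryTheory.Limits AlgebraicGeometry TensorProduct
open Literature.AlgebraicGeometry.Motives Literature.AlgebraicGeometry.Motives.WittScheme

namespace Literature.AlgebraicGeometry.Deformation

namespace WittAffine

variable (p : ℕ) [Fact p.Prime] (k : Type) [CommRing k]
variable (S : Type) [CommRing S] [Algebra (WittVector p k) S]

/-- `(p^n) W(k) · S = (p^n) S`. [folklore] -/
theorem map_span_pow (n : ℕ) :
    (Ideal.span {(p : WittVector p k)} ^ n).map (algebraMap (WittVector p k) S) =
      Ideal.span {(p : S)} ^ n := by
  rw [Ideal.map_pow, Ideal.map_span, Set.image_singleton, map_natCast]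

/-- `S/p^n S ≅ S ⊗_{W(k)} W_n(k)` as `S`-algebras (Mathlib
`Algebra.TensorProduct.quotIdealMapEquivTensorQuot`). [folklore] -/
def quotEquivTensor (n : ℕ) :
    (S ⧸ Ideal.span {(p : S)} ^ n) ≃ₐ[S] S ⊗[WittVector p k] wittQuot p k n :=
  (Ideal.quotientEquivAlgOfEq S (map_span_pow p k S n).symm).trans
    (Algebra.TensorProduct.quotIdealMapEquivTensorQuot S (Ideal.span {(p : WittVector p k)} ^ n))

/-- `S/p^nS ≅ S ⊗_W W_n` on residue classes: `s̄ ↦ s ⊗ 1` (by `rfl`). [folklore] -/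
theorem quotEquivTensor_mk (n : ℕ) (s : S) :
    quotEquivTensor p k S n (Ideal.Quotient.mk _ s) = s ⊗ₜ 1 := rfl

/-- The inverse of `S/p^nS ≅ S ⊗_W W_n` on `s ⊗ 1`. [folklore] -/
theorem quotEquivTensor_symm_tmul_one (n : ℕ) (s : S) :
    (quotEquivTensor p k S n).symm (s ⊗ₜ 1) = Ideal.Quotient.mk _ s :=
  (AlgEquiv.symm_apply_eq _).mpr (quotEquivTensor_mk p k S n s).symm

/-- The inverse of `S/p^nS ≅ S ⊗_W W_n` on `1 ⊗ w̄` is the class of the image of `w` in `S`.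
[folklore] -/
theorem quotEquivTensor_symm_one_tmul (n : ℕ) (w : WittVector p k) :
    (quotEquivTensor p k S n).symm (1 ⊗ₜ Ideal.Quotient.mk _ w) =
      Ideal.Quotient.mk _ (algebraMap (WittVector p k) S w) := by
  rw [AlgEquiv.symm_apply_eq, quotEquivTensor_mk, Algebra.algebraMap_eq_smul_one,
    TensorProduct.smul_tmul, Algebra.smul_def, mul_one, Ideal.Quotient.algebraMap_eq]

/-- `p^n W ≤ (algebraMap)⁻¹ (p^n S)`. [folklore] -/
theorem span_pow_le_comap (n : ℕ) :
    Ideal.span {(p : WittVector p k)} ^ n ≤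
      (Ideal.span {(p : S)} ^ n).comap (algebraMap (WittVector p k) S) :=
  Ideal.map_le_iff_le_comap.mp (map_span_pow p k S n).le

/-- The structure map `W_n(k) = W(k)/p^n → S/p^n S`. [folklore] -/
abbrev quotAlgebraMap (n : ℕ) : wittQuot p k n →+* S ⧸ Ideal.span {(p : S)} ^ n :=
  Ideal.quotientMap _ (algebraMap (WittVector p k) S) (span_pow_le_comap p k S n)

/-- `X_n = Spec S ×_{Spec W} Spec W_n` as a fibre product of spectra (this is
`(thickening (specOver W S) n).left` by `rfl`). [folklore] -/
abbrev wittPullback (n : ℕ) : Scheme :=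
  pullback (Spec.map (CommRingCat.ofHom (algebraMap (WittVector p k) S)))
    (Spec.map (CommRingCat.ofHom (algebraMap (WittVector p k) (wittQuot p k n))))

/-- The transition map `X_{n+1} → X_{n+2}` (this is `thickeningMap (specOver W S) (Nat.le_succ (n+1))`
by `rfl`). [folklore] -/
abbrev wittTransition (n : ℕ) : wittPullback p k S (n + 1) ⟶ wittPullback p k S (n + 1 + 1) :=
  pullback.map _ _ _ _ (𝟙 _)
    (Spec.map (CommRingCat.ofHom (Ideal.Quotient.factor
      (Ideal.pow_le_pow_right (Nat.le_succ (n + 1)))))) (𝟙 _)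
    (by rw [Category.comp_id, Category.id_comp])
    (by rw [Category.comp_id, ← Spec.map_comp, ← CommRingCat.ofHom_comp]; rfl)

/-- The underlying scheme of the `n`-th thickening of `Spec S → Spec W` is the fibre product of
spectra `wittPullback n` (by `rfl`). [folklore] -/
theorem thickening_specOver_left (n : ℕ) :
    (thickening (specOver (WittVector p k) S) n).left = wittPullback p k S n := rfl

/-- The transition map of thickenings of `Spec S → Spec W` is `wittTransition` (by `rfl`). [folklore] -/
theorem thickeningMap_specOver (n : ℕ) :
    thickeningMap (specOver (WittVector p k) S) (Nat.le_succ (n + 1)) = wittTransition p k S n := rfl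

/-- The immersion `X_n → Spec S` of a thickening of `Spec S → Spec W` is the first projection
(by `rfl`). [folklore] -/
theorem thickeningι_specOver (n : ℕ) :
    thickeningι (specOver (WittVector p k) S) n = pullback.fst _ _ := rfl

/-- `Spec (S/p^{n+1}S) ≅ Spec (S ⊗_W W_{n+1})`. [folklore] -/
def specQuotIsoSpecTensor (n : ℕ) :
    Spec (.of (S ⧸ Ideal.span {(p : S)} ^ (n + 1))) ≅
      Spec (.of (S ⊗[WittVector p k] wittQuot p k (n + 1))) where
  hom := Spec.map (CommRingCat.ofHom (quotEquivTensor p k S (n + 1)).symm.toRingEquiv.toRingHom)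
  inv := Spec.map (CommRingCat.ofHom (quotEquivTensor p k S (n + 1)).toRingEquiv.toRingHom)
  hom_inv_id := by
    rw [← Spec.map_comp, ← CommRingCat.ofHom_comp, ← Spec.map_id]
    exact congrArg Spec.map (CommRingCat.hom_ext
      (RingHom.ext fun x => (quotEquivTensor p k S (n + 1)).symm_apply_apply x))
  inv_hom_id := by
    rw [← Spec.map_comp, ← CommRingCat.ofHom_comp, ← Spec.map_id]
    exact congrArg Spec.map (CommRingCat.hom_ext
      (RingHom.ext fun x => (quotEquivTensor p k S (n + 1)).apply_symm_apply x))

/-- **The thickenings of an affine `W(k)`-scheme**: `Spec (S/p^{n+1}S) ≅ X_{n+1}` for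
`𝒳 = Spec S → Spec W(k)` (`X_{n+1} = Spec S ×_W Spec W_{n+1} ≅ Spec (S ⊗_W W_{n+1}) ≅ Spec (S/p^{n+1}S)`,
Mathlib `pullbackSpecIso`). [folklore] -/
def specQuotIso (n : ℕ) :
    Spec (.of (S ⧸ Ideal.span {(p : S)} ^ (n + 1))) ≅ wittPullback p k S (n + 1) :=
  specQuotIsoSpecTensor p k S n ≪≫ (pullbackSpecIso (WittVector p k) S (wittQuot p k (n + 1))).symm

/-- `Spec (S/p^{n+1}S) ≅ X_{n+1} → Spec S` is `Spec` of `S → S/p^{n+1}S`. [folklore] -/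
@[reassoc]
theorem specQuotIso_hom_fst (n : ℕ) :
    (specQuotIso p k S n).hom ≫ pullback.fst _ _ =
      Spec.map (CommRingCat.ofHom (algebraMap S (S ⧸ Ideal.span {(p : S)} ^ (n + 1)))) := by
  rw [specQuotIso, Iso.trans_hom, Iso.symm_hom, Category.assoc, pullbackSpecIso_inv_fst]
  change Spec.map (CommRingCat.ofHom _) ≫ _ = _
  rw [← Spec.map_comp, ← CommRingCat.ofHom_comp]
  exact congrArg (fun φ => Spec.map (CommRingCat.ofHom φ))
    (RingHom.ext fun s => quotEquivTensor_symm_tmul_one p k S (n + 1) s)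

/-- `Spec (S/p^{n+1}S) ≅ X_{n+1} → Spec W_{n+1}` is `Spec` of `W_{n+1} → S/p^{n+1}S`. [folklore] -/
@[reassoc]
theorem specQuotIso_hom_snd (n : ℕ) :
    (specQuotIso p k S n).hom ≫ pullback.snd _ _ =
      Spec.map (CommRingCat.ofHom (quotAlgebraMap p k S (n + 1))) := by
  rw [specQuotIso, Iso.trans_hom, Iso.symm_hom, Category.assoc, pullbackSpecIso_inv_snd]
  change Spec.map (CommRingCat.ofHom _) ≫ Spec.map (CommRingCat.ofHom _) = _
  rw [← Spec.map_comp, ← CommRingCat.ofHom_comp]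
  exact congrArg (fun φ => Spec.map (CommRingCat.ofHom φ))
    (Ideal.Quotient.ringHom_ext (RingHom.ext fun w => by
      change (quotEquivTensor p k S (n + 1)).symm (1 ⊗ₜ Ideal.Quotient.mk _ w) = _
      rw [quotEquivTensor_symm_one_tmul, RingHom.comp_apply, Ideal.quotientMap_mk]))

/-- **The isomorphisms `Spec (S/p^{n+1}S) ≅ X_{n+1}` form a morphism of towers**: they commute
with the transition maps `Spec (S/p^{n+1}) → Spec (S/p^{n+2})` and `X_{n+1} → X_{n+2}`. [folklore] -/
theorem specQuotIso_comm (n : ℕ) :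
    Spec.map (CommRingCat.ofHom (Ideal.Quotient.factorPowSucc (Ideal.span {(p : S)}) (n + 1))) ≫
        (specQuotIso p k S (n + 1)).hom =
      (specQuotIso p k S n).hom ≫ wittTransition p k S n := by
  refine pullback.hom_ext ?_ ?_
  · rw [Category.assoc, Category.assoc, specQuotIso_hom_fst, pullback.lift_fst, Category.comp_id,
      specQuotIso_hom_fst, ← Spec.map_comp, ← CommRingCat.ofHom_comp]
    rfl
  · rw [Category.assoc, Category.assoc, specQuotIso_hom_snd, pullback.lift_snd,
      specQuotIso_hom_snd_assoc, ← Spec.map_comp, ← Spec.map_comp, ← CommRingCat.ofHom_comp,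
      ← CommRingCat.ofHom_comp]
    exact congrArg (fun φ => Spec.map (CommRingCat.ofHom φ))
      (Ideal.Quotient.ringHom_ext (RingHom.ext fun w => by
        simp only [RingHom.comp_apply, Ideal.quotientMap_mk, Ideal.Quotient.factor_mk,
          Ideal.Quotient.factorPowSucc, Ideal.Quotient.factorPow]))

/-! ### Cancelling the inverse image along an isomorphism -/

/-- `e.inv^* e.hom^* ℳ ≅ ℳ` for an isomorphism of schemes `e`. [folklore] -/
def pullbackInvHomIso {X Y : Scheme} (e : X ≅ Y) (M : Y.Modules) :
    (Scheme.Modules.pullback e.inv).obj ((Scheme.Modules.pullback e.hom).obj M) ≅ M :=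
  (Scheme.Modules.pullbackComp e.inv e.hom).app M ≪≫
    (Scheme.Modules.pullbackCongr e.inv_hom_id).app M ≪≫ (Scheme.Modules.pullbackId Y).app M

/-- Modules with isomorphic inverse images along an ISOMORPHISM are isomorphic. [folklore] -/
theorem nonempty_iso_of_pullback_hom_iso {X Y : Scheme} (e : X ≅ Y) {M N : Y.Modules}
    (i : (Scheme.Modules.pullback e.hom).obj M ≅ (Scheme.Modules.pullback e.hom).obj N) :
    Nonempty (M ≅ N) :=
  ⟨(pullbackInvHomIso e M).symm ≪≫ (Scheme.Modules.pullback e.inv).mapIso i ≪≫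
    pullbackInvHomIso e N⟩


/-! ### Grothendieck existence for vector bundles on an affine `W(k)`-scheme -/

section Assembly

open Literature.AlgebraicGeometry.FormalGeometry

variable [IsAdicComplete (Ideal.span {(p : S)}) S]

/-- **Görtz–Wedhorn II, Thm. 24.94 for vector bundles, affine case over `W(k)`**: for a
`p`-adically complete `W(k)`-algebra `S` and `𝒳 = Spec S`, every compatible system `(ℰ_n)_n` of
vector bundles on the thickenings `X_{n+1} = 𝒳 ⊗_W W_{n+1}(k)` is, level by level, the restriction
of a vector bundle `ℱ` on `𝒳`. (The conclusion of
`GortzWedhorn2023_thm2494_vectorBundle_witt` for affine `𝒳`, with properness replaced by the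
completeness of `S` that it implies.) Proof: transport the system along the isomorphisms of towers
`Spec (S/p^{n+1}S) ≅ X_{n+1}` (`specQuotIso`, `TowerModule.baseChange`), apply the affine
algebraization theorem `exists_vectorBundle_of_isVectorBundle_adicTower` (GW Prop. 24.88 in sheaf
form), and cancel the inverse image along the isomorphisms.
[cite: GortzWedhorn2023, Thm. 24.94 with Prop. 24.88 / Cor. 24.90 (pp. 562–566)] -/
theorem exists_vectorBundle_forall_thickening_iso
    (E : ∀ n, (thickening (specOver (WittVector p k) S) (n + 1)).left.Modules)
    (hE : ∀ n, IsVectorBundle (E n))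
    (hc : ∀ n, Nonempty ((Scheme.Modules.pullback
      (thickeningMap (specOver (WittVector p k) S) (Nat.le_succ (n + 1)))).obj (E (n + 1)) ≅ E n)) :
    ∃ F : (specOver (WittVector p k) S).left.Modules, IsVectorBundle F ∧
      ∀ n, Nonempty ((Scheme.Modules.pullback
        (thickeningι (specOver (WittVector p k) S) (n + 1))).obj F ≅ E n) := by
  -- the system as a module over the tower of thickenings, moved to the adic tower of `S`
  let T : FormalModule (specOver (WittVector p k) S) := TowerModule.ofNonemptyIso E hc
  have hT : T.IsVectorBundle := fun n => hE n
  -- base change along the isomorphisms of towers `Spec (S/p^{n+1}S) ≅ X_{n+1}` (GW Constr. 24.104,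
  -- `TowerModule.baseChange`; inlined: `(t' n)^* φ_{n+1}^* ≅ (t' n ≫ φ_{n+1})^* = (φ_n ≫ t n)^* ≅ φ_n^* (t n)^*`)
  let E' : TowerModule (adicLevel S (Ideal.span {(p : S)})) (adicTransition S (Ideal.span {(p : S)})) :=
    { obj := fun n => (Scheme.Modules.pullback (specQuotIso p k S n).hom).obj (T.obj n)
      iso := fun n =>
        (Scheme.Modules.pullbackComp (adicTransition S (Ideal.span {(p : S)}) n)
            (specQuotIso p k S (n + 1)).hom).app _ ≪≫
          (Scheme.Modules.pullbackCongr (specQuotIso_comm p k S n)).app _ ≪≫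
          (Scheme.Modules.pullbackComp (specQuotIso p k S n).hom
            (thickeningMap (specOver (WittVector p k) S) (Nat.le_succ (n + 1)))).symm.app _ ≪≫
          (Scheme.Modules.pullback (specQuotIso p k S n).hom).mapIso (T.iso n) }
  have hE' : E'.IsVectorBundle := fun n => (hT n).pullback (specQuotIso p k S n).hom
  obtain ⟨F, hF, hiso⟩ :=
    exists_vectorBundle_of_isVectorBundle_adicTower S (Ideal.span {(p : S)}) E' hE'
  refine ⟨F, hF, fun n => ?_⟩
  obtain ⟨a⟩ := hiso n
  have hι : (specQuotIso p k S n).hom ≫ thickeningι (specOver (WittVector p k) S) (n + 1) =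
      adicImmersion S (Ideal.span {(p : S)}) n :=
    specQuotIso_hom_fst p k S n
  exact nonempty_iso_of_pullback_hom_iso (specQuotIso p k S n)
    ((Scheme.Modules.pullbackComp (specQuotIso p k S n).hom
        (thickeningι (specOver (WittVector p k) S) (n + 1))).app F ≪≫
      (Scheme.Modules.pullbackCongr hι).app F ≪≫ a)

end Assembly

end WittAffine

end Literature.AlgebraicGeometry.Deformation
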